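import Literature.Probability.RandomPlanarGeometry.HexSAW
import Mathlib.Analysis.SpecialFunctions.Pow.Real
import HarnessLib

/-!
# Self-avoiding walk on `ℤ²` with Yang–Baxter weights (Glazman–Manolescu)

Topic `Literature/Probability/RandomPlanarGeometry`; definition request `defn-YangBaxterSAWWeights`
(item `wi-04960`, route `CriticalPhenomena/SAWScalingLimit/SAWHexUniversality`): the objects of
A. Glazman, I. Manolescu, *Self-avoiding walk on `ℤ²` with Yang–Baxter weights: universality of
critical fugacity and 2-point function*, Ann. Inst. Henri Poincaré Probab. Stat. 56 (2020),
arXiv:1708.00395v3 (bib key `GlazmanManolescu2019`; numbering below is that of the arXiv version),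
§1:

* "Consider a series of angles `Θ = {θ_k}_{k∈ℕ}`, where `θ_k ∈ [π/3, 2π/3]` for all `k`. Denote by
  `H(Θ)` the right half-plane tiled with columns of rhombi of edge-length `1` in such a way that
  all rhombi in the `k`-th column from the left have upper-left angle `θ_k`. … Embed `H(Θ)` so
  that the origin `0` is the mid-point of a vertical edge of the boundary. Denote by `Strip_T(Θ)`
  the strip consisting of the `T` leftmost columns of `H(Θ)`."
* "A self-avoiding walk on `H(Θ)` is a simple curve `γ` starting and ending at midpoints of edges,
  intersecting edges at right angles and traversing each rhombus in one of the ways depicted in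
  Fig. 1" (abstract: "This walk can traverse the same face twice, but crosses any edge at most
  once"). "The weight `w_Θ(γ)` of a self-avoiding walk `γ` is the product of weights associated
  to each rhombus; for a rhombus of angle `θ` the weight, depending on the configuration of arcs
  inside it, takes one of the six possible values: `1, u₁(θ), u₂(θ), v(θ), w₁(θ), w₂(θ)`", given
  by eq. (1) (Nienhuis 1990):
  `u₁ = sin(5π/4) sin(5π/8 + 3θ/8) / [sin(5π/4 + 3θ/8) sin(5π/8 − 3θ/8)]`,
  `u₂ = sin(5π/4) sin(3θ/8) / [same]`, `v = sin(5π/8 + 3θ/8) sin(−3θ/8) / [same]`,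
  `w₁ = sin(5π/8 + 3θ/8) sin(5π/4 − 3θ/8) / [same]`, `w₂ = sin(15π/8 + 3θ/8) sin(−3θ/8) / [same]`.
* "the 2-point function between `a` and `b`, denoted by `G_Θ(a, b)`, is the sum of weights of all
  walks from `a` to `b` on `H(Θ)`" (`a`, `b` "points with integer coordinates on the boundary of
  the right half-plane"); "A bridge of width `T` is a SAW on `Strip_T(Θ)`, starting at `0` and
  ending on the right boundary of `Strip_T(Θ)`. The partition function of bridges of width `T` is
  `B_{T,Θ} = Σ_{γ bridge in Strip_T(Θ)} w_Θ(γ)`" (2).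
* Length `|γ|` ("the sum of lengths of each arc, where the lengths of an arc spanning an angle `θ`
  is `3θ/π` and the length of any straight segment traversing a rhombus is `2`"), boundary
  visits `b(γ)`, the deformed weight `w_Θ(γ; x, y) = w_Θ(γ) x^{|γ|} y^{b(γ)}` (4),
  `SAW_Θ(x, y) = Σ_{γ starts at 0} w_Θ(γ; x, y)` and the critical fugacity
  `y_c(Θ) = sup{y ≥ 0 | ∀ 0 < x < 1, SAW_Θ(x, y) < ∞}` (Definition 1.1, (5)).
* NAMED FACTS (as `def … : Prop`): Theorem 1 (`G_Θ(a,b) = G_{π/3}(a,b)`) and Theorem 2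
  (`B_{T,Θ} → 0`) are stated here (and discharged in `YangBaxterSAWTheoremsHolds.lean`);
  Proposition 1.1 (rendered as `Σ_T B_{T,π/3}/T < ∞` — a MIS-QUOTATION: the printed eq. (3) is
  `Σ_T (B_{T,π/3})³/T < ∞`, with the cube; see `YangBaxterSAWBridgeDecay.lean`) and Theorem 3
  (`y_c(Θ) = 1 + √2` when `θ₁ = π/3`), both undischarged, live in `YangBaxterSAWFacts.lean`
  (moved out of this definitions file verbatim, so that the import cone of the routes stated over
  these objects contains no unproved fact).

## Combinatorial encoding (namespace `Literature.SAW.YangBaxter`)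

Whatever the angles, `H(Θ)` is combinatorially the square grid: we index the rhombi ("faces") by
`(k, j) ∈ ℤ × ℤ` (`k` = column, counted from `0` at the boundary — the paper's `θ_k`, `k ≥ 1`, is
our `Θ (k - 1)` —, `j` = row, row `0` containing the origin on its left side, as in §2.1) and
the edges ("mid-edges") by `MidEdge.vert k j` (the left side of face `(k, j)` = right side of
`(k-1, j)`; the boundary of `H` is `{vert 0 j}`) and `MidEdge.slant k j` (the bottom side of
`(k, j)` = top side of `(k, j-1)`). The angles enter only through the weights (and the plane
embedding `corner`/`midpoint`, provided for item (i) but not used by the partition functions).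
A domain is a set of faces `D : Set Face` (`halfPlane`, `strip T`, `rect T L`), and the angle
sequence is `Θ : ℤ → ℝ` (column `k ↦ θ`; values at `k < 0` are never used in `halfPlane`).

A SAW (`YBWalk D a z`) is the list `a = z₀, z₁, …, zₙ = z` of the mid-edges it crosses, pairwise
distinct ("crosses any edge at most once"), consecutive ones being two sides of a common face of
`D` (the arc `zᵢ₋₁ → zᵢ` drawn inside that face), consecutive arcs lying in DIFFERENT faces (the
curve crosses each edge transversally, passing to the face on the other side — in particular a
walk touching the boundary of `D` stops there), and in no face do the two straight arcs `{W,E}`,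
`{S,N}` both occur (the only crossing pattern; Fig. 1 lists exactly the non-crossing ones). Since
mid-edges are not repeated, a face carries at most two arcs, with disjoint end-sides.

The six local pictures of Fig. 1, for a rhombus with upper-left (= lower-right) angle `θ` and
sides `W, N, E, S`: no arc ↦ `1`; one arc joining the two sides at a `θ`-corner (`{W,N}` or
`{S,E}`) ↦ `u₁(θ)`; one arc at a `(π−θ)`-corner (`{W,S}` or `{N,E}`) ↦ `u₂(θ)`; one straight
arc (`{W,E}` or `{N,S}`) ↦ `v(θ)`; two `θ`-corner arcs ↦ `w₁(θ)`; two `(π−θ)`-corner arcs ↦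
`w₂(θ)`. (This is forced by §1/Fig. 2: at `θ = π/3` the rhombus splits into two equilateral
triangles along the diagonal joining the `(π−θ)`-corners, "each contributing `1/√(2+√2)` if
traversed by an arc", and "`w₂ = 0` and `v = w₁ = u₂ = u₁²`", `u₁ = x_c`: the one-triangle arcs are
those at the `θ`-corners; also "replacing `θ` by `π − θ` exchanges `u₁` with `u₂` and `w₁` with
`w₂`, but does not affect `v`".)

Partition functions are `ℝ≥0∞`-valued `tsum`s of `ENNReal.ofReal (weight)` (the weights are
`≥ 0` exactly for `θ ∈ [π/3, 2π/3]`, p. 2; outside that range negative local weights are clamped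
to `0` — junk regime), so that no summability bookkeeping is needed (`G_Θ`, `B_T` are finite by
Cor. 2.3 of the paper, but `SAW_Θ(x, y)` is genuinely `∞` for large `y`).

At `Θ ≡ π/3` the model "becomes that on the hexagonal lattice … with weight `(1/√(2+√2))^{|γ|}`"
(p. 3); the hexagonal carrier is `Literature.Probability.RandomPlanarGeometry.SAW.HexDomainSAW`/`hexCriticalFugacity` (`HexSAW.lean`); we
record `weightU1 (π/3) = hexCriticalFugacity` and `weightW2 (π/3) = 0`; the bijection of walks itself is
part of the (unvendored) proofs.
-/

noncomputable section

open Real Filter Topology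
open scoped ENNReal

namespace Literature.Probability.RandomPlanarGeometry.SAW.YangBaxter

/-! ### The grid: faces, mid-edges, sides -/

/-- A rhombus (face) of the tiling: `(k, j)` = column `k` (from the boundary column `0`), row `j`.
[cite: GlazmanManolescu2019, §1 and §2.1] -/
abbrev Face : Type := ℤ × ℤ

/-- The edges of the tiling, through their midpoints ("mid-edges"): `vert k j` is the left side of
face `(k, j)` (a vertical unit segment; the right side of face `(k-1, j)`), `slant k j` the bottom
side of face `(k, j)` (the top side of `(k, j-1)`). [cite: GlazmanManolescu2019, §1] -/
inductive MidEdge : Type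
  | vert (k j : ℤ)
  | slant (k j : ℤ)
  deriving DecidableEq, Repr

/-- The four sides of a rhombus: West (left, vertical), East (right, vertical), South (bottom),
North (top); the upper-left corner `N ∩ W` and the lower-right corner `S ∩ E` have angle `θ`,
the other two `π − θ`. [cite: GlazmanManolescu2019, §1, Fig. 4 (z_W, z_E, z_S, z_N)] -/
inductive Side : Type
  | W | E | S | N
  deriving DecidableEq, Repr, Fintype

namespace Face

/-- The mid-edge on side `s` of the face `f`. [cite: GlazmanManolescu2019, Fig. 4] -/
def side (f : Face) : Side → MidEdge
  | .W => .vert f.1 f.2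
  | .E => .vert (f.1 + 1) f.2
  | .S => .slant f.1 f.2
  | .N => .slant f.1 (f.2 + 1)

/-- Which side of `f` the mid-edge `e` lies on (`none` if `e` is not a side of `f`). [folklore] -/
def sideOf (f : Face) : MidEdge → Option Side
  | .vert k j =>
    if k = f.1 ∧ j = f.2 then some .W else if k = f.1 + 1 ∧ j = f.2 then some .E else none
  | .slant k j =>
    if k = f.1 ∧ j = f.2 then some .S else if k = f.1 ∧ j = f.2 + 1 then some .N else none

end Face

namespace MidEdge

/-- The two faces bordering a mid-edge (left/lower one first). [folklore] -/
def faces : MidEdge → Face × Face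
  | .vert k j => ((k - 1, j), (k, j))
  | .slant k j => ((k, j - 1), (k, j))

/-- The common face of two distinct mid-edges, if any (two distinct edges of the square grid
border at most one common face); `none` for `e = e'`. [folklore] -/
def commonFace (e e' : MidEdge) : Option Face :=
  if e = e' then none
  else if e.faces.1 = e'.faces.1 ∨ e.faces.1 = e'.faces.2 then some e.faces.1
  else if e.faces.2 = e'.faces.1 ∨ e.faces.2 = e'.faces.2 then some e.faces.2
  else none

end MidEdge

open MidEdge

/-! ### Domains and the embedding `H(Θ)` -/

/-- The right half-plane `H(Θ)`: all faces of columns `k ≥ 0`. [cite: GlazmanManolescu2019, §1] -/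
def halfPlane : Set Face := {f | 0 ≤ f.1}

/-- `Strip_T(Θ)`: "the `T` leftmost columns of `H(Θ)`" (columns `0, …, T-1`; its right boundary
is `{vert T j}`). [cite: GlazmanManolescu2019, §1] -/
def strip (T : ℕ) : Set Face := {f | 0 ≤ f.1 ∧ f.1 < T}

/-- `Rect_{T,L}(Θ)`: "the rows `−L, …, L` of `Strip_T(Θ)`". [cite: GlazmanManolescu2019, §2.1] -/
def rect (T L : ℕ) : Set Face := {f | 0 ≤ f.1 ∧ f.1 < T ∧ -(L : ℤ) ≤ f.2 ∧ f.2 ≤ L}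

/-- The origin `0`: the midpoint of the boundary vertical edge of row `0`.
[cite: GlazmanManolescu2019, §1] -/
def origin : MidEdge := .vert 0 0

/-- The boundary point of `H(Θ)` with integer coordinate `m`: the midpoint of the boundary edge of
row `m`. [cite: GlazmanManolescu2019, §1 (points with integer coordinates on the boundary)] -/
def boundaryPoint (m : ℤ) : MidEdge := .vert 0 m

/-- The translation vector from the left to the right side of a rhombus of column `k` (upper-left
angle `θ = Θ k`, unit sides): `(sin θ, −cos θ)`. [cite: GlazmanManolescu2019, §1] -/
def colShift (Θ : ℤ → ℝ) (k : ℤ) : ℂ :=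
  (Real.sin (Θ k) : ℂ) - (Real.cos (Θ k) : ℂ) * Complex.I

/-- The lower-left corner of the rhombus `(k, j)` of `H(Θ)` (for `k ≥ 0`; columns `k < 0` are sent
onto column `0`), normalised so that the origin is the midpoint of `vert 0 0`.
[cite: GlazmanManolescu2019, §1] -/
def corner (Θ : ℤ → ℝ) (f : Face) : ℂ :=
  (f.2 : ℂ) * Complex.I - Complex.I / 2 + ∑ i ∈ Finset.range f.1.toNat, colShift Θ i

/-- The point of the plane that is the midpoint of the edge `e` of `H(Θ)`.
[cite: GlazmanManolescu2019, §1] -/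
def midpoint (Θ : ℤ → ℝ) : MidEdge → ℂ
  | .vert k j => corner Θ (k, j) + Complex.I / 2
  | .slant k j => corner Θ (k, j) + colShift Θ k / 2

/-! ### The local Yang–Baxter weights (eq. (1)) -/

/-- The common denominator `sin(5π/4 + 3θ/8) sin(5π/8 − 3θ/8)` of eq. (1).
[cite: GlazmanManolescu2019, eq. (1)] -/
def weightDen (θ : ℝ) : ℝ := sin (5 * π / 4 + 3 * θ / 8) * sin (5 * π / 8 - 3 * θ / 8)

/-- `u₁(θ) = sin(5π/4) sin(5π/8 + 3θ/8) / [sin(5π/4 + 3θ/8) sin(5π/8 − 3θ/8)]`: one arc at a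
`θ`-corner. [cite: GlazmanManolescu2019, eq. (1)] -/
def weightU1 (θ : ℝ) : ℝ := sin (5 * π / 4) * sin (5 * π / 8 + 3 * θ / 8) / weightDen θ

/-- `u₂(θ) = sin(5π/4) sin(3θ/8) / [sin(5π/4 + 3θ/8) sin(5π/8 − 3θ/8)]`: one arc at a
`(π−θ)`-corner. [cite: GlazmanManolescu2019, eq. (1)] -/
def weightU2 (θ : ℝ) : ℝ := sin (5 * π / 4) * sin (3 * θ / 8) / weightDen θ

/-- `v(θ) = sin(5π/8 + 3θ/8) sin(−3θ/8) / [sin(5π/4 + 3θ/8) sin(5π/8 − 3θ/8)]`: one straight arc.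
[cite: GlazmanManolescu2019, eq. (1)] -/
def weightV (θ : ℝ) : ℝ := sin (5 * π / 8 + 3 * θ / 8) * sin (-(3 * θ / 8)) / weightDen θ

/-- `w₁(θ) = sin(5π/8 + 3θ/8) sin(5π/4 − 3θ/8) / [sin(5π/4 + 3θ/8) sin(5π/8 − 3θ/8)]`: two arcs at
the two `θ`-corners. [cite: GlazmanManolescu2019, eq. (1)] -/
def weightW1 (θ : ℝ) : ℝ := sin (5 * π / 8 + 3 * θ / 8) * sin (5 * π / 4 - 3 * θ / 8) / weightDen θ

/-- `w₂(θ) = sin(15π/8 + 3θ/8) sin(−3θ/8) / [sin(5π/4 + 3θ/8) sin(5π/8 − 3θ/8)]`: two arcs at the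
two `(π−θ)`-corners. [cite: GlazmanManolescu2019, eq. (1)] -/
def weightW2 (θ : ℝ) : ℝ := sin (15 * π / 8 + 3 * θ / 8) * sin (-(3 * θ / 8)) / weightDen θ

/-- The kind of an arc inside a rhombus, read off from its two end-sides: at a `θ`-corner
(`{W,N}`, `{S,E}`), at a `(π−θ)`-corner (`{W,S}`, `{N,E}`), straight (`{W,E}`, `{S,N}`), or
degenerate (equal sides; never occurs in a walk). [cite: GlazmanManolescu2019, Fig. 1] -/
inductive ArcKind : Type
  | corner | coCorner | straight | degen
  deriving DecidableEq, Repr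

/-- The kind of the arc joining sides `s` and `t`. [cite: GlazmanManolescu2019, Fig. 1] -/
def arcKind : Side → Side → ArcKind
  | .W, .N | .N, .W | .S, .E | .E, .S => .corner
  | .W, .S | .S, .W | .N, .E | .E, .N => .coCorner
  | .W, .E | .E, .W | .S, .N | .N, .S => .straight
  | .W, .W | .E, .E | .S, .S | .N, .N => .degen

/-- **The local weight of a rhombus of angle `θ`** as a function of the arcs it contains (Fig. 1):
`1, u₁, u₂, v, w₁, w₂`; every other configuration (which a `YBWalk` never produces) gets `0`.
[cite: GlazmanManolescu2019, §1, Fig. 1, eq. (1)] -/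
def localWeight (θ : ℝ) : List ArcKind → ℝ
  | [] => 1
  | [.corner] => weightU1 θ
  | [.coCorner] => weightU2 θ
  | [.straight] => weightV θ
  | [.corner, .corner] => weightW1 θ
  | [.coCorner, .coCorner] => weightW2 θ
  | _ => 0

/-- The length of an arc: "an arc spanning an angle `θ` [has length] `3θ/π` and … any straight
segment traversing a rhombus [has length] `2`" (so that at `Θ ≡ π/3` the length is the number of
hexagonal-lattice edges). [cite: GlazmanManolescu2019, §1 (before (4))] -/
def arcLength (θ : ℝ) : ArcKind → ℝ
  | .corner => 3 * θ / π
  | .coCorner => 3 * (π - θ) / π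
  | .straight => 2
  | .degen => 0

/-! ### Walks -/

/-- The arcs (pairs of consecutive mid-edges) of a list of mid-edges. [folklore] -/
def arcsOf (l : List MidEdge) : List (MidEdge × MidEdge) := l.zip l.tail

/-- The face an arc is drawn in (`none` if its ends are not two sides of one face). [folklore] -/
def arcFace (p : MidEdge × MidEdge) : Option Face := commonFace p.1 p.2

/-- The kind of an arc, relative to the face it is drawn in. [folklore] -/
def arcKindOf (p : MidEdge × MidEdge) : Option ArcKind :=
  (arcFace p).bind fun f =>
    match f.sideOf p.1, f.sideOf p.2 with
    | some s, some t => some (arcKind s t)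
    | _, _ => none

/-- **A self-avoiding walk of the Yang–Baxter model** in the domain `D` (a set of rhombi) from the
mid-edge `a` to the mid-edge `z`: the list `a = z₀, …, zₙ = z` (`n ≥ 0`) of mid-edges crossed,
pairwise distinct, consecutive ones on a common face of `D` (the arc between them), consecutive
arcs in different faces (edges are crossed transversally), and no face containing the two
crossing straight arcs. [cite: GlazmanManolescu2019, §1 (definition of the model), Fig. 1] -/
@[ext] structure YBWalk (D : Set Face) (a z : MidEdge) : Type where
  /-- the mid-edges `z₀ = a, z₁, …, zₙ = z` crossed, in order -/
  mids : List MidEdge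
  /-- the walk starts at `a` -/
  head_eq : mids.head? = some a
  /-- the walk ends at `z` -/
  getLast_eq : mids.getLast? = some z
  /-- "crosses any edge at most once" -/
  nodup : mids.Nodup
  /-- each arc is drawn in a rhombus of the domain -/
  arc_mem : ∀ p ∈ arcsOf mids, ∃ f ∈ D, arcFace p = some f
  /-- consecutive arcs lie in different rhombi (the edge between them is crossed) -/
  isChain : (arcsOf mids).IsChain fun p q => arcFace p ≠ arcFace q
  /-- the curve is simple: no rhombus contains both straight (crossing) arcs -/
  noncross : ∀ f : Face,
    ((f.side .W, f.side .E) ∈ arcsOf mids ∨ (f.side .E, f.side .W) ∈ arcsOf mids) →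
      ¬((f.side .S, f.side .N) ∈ arcsOf mids ∨ (f.side .N, f.side .S) ∈ arcsOf mids)

namespace YBWalk

variable {D : Set Face} {a z : MidEdge}

/-- The arcs of the walk. [folklore] -/
abbrev arcs (γ : YBWalk D a z) : List (MidEdge × MidEdge) := arcsOf γ.mids

/-- The rhombi visited (containing at least one arc), as a finite set. [folklore] -/
def facesVisited (γ : YBWalk D a z) : Finset Face := (γ.arcs.filterMap arcFace).toFinset

/-- The kinds of the arcs of `γ` inside the rhombus `f` (a list of length `≤ 2`).
[cite: GlazmanManolescu2019, Fig. 1] -/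
def kindsIn (γ : YBWalk D a z) (f : Face) : List ArcKind :=
  γ.arcs.filterMap fun p => if arcFace p = some f then arcKindOf p else none

/-- **The Yang–Baxter weight `w_Θ(γ)`**: "the product of weights associated to each rhombus"
(rhombi without arcs contribute `1`). [cite: GlazmanManolescu2019, §1] -/
def weight (Θ : ℤ → ℝ) (γ : YBWalk D a z) : ℝ :=
  ∏ f ∈ γ.facesVisited, localWeight (Θ f.1) (γ.kindsIn f)

/-- **The length `|γ|`**: the sum of the lengths of the arcs (`3θ/π` for an arc spanning an angle
`θ`, `2` for a straight one). [cite: GlazmanManolescu2019, §1 (before (4))] -/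
def length (Θ : ℤ → ℝ) (γ : YBWalk D a z) : ℝ :=
  (γ.arcs.filterMap fun p =>
    (arcFace p).bind fun f => (arcKindOf p).map fun κ => arcLength (Θ f.1) κ).sum

/-- **`b(γ)`, the number of visits to the boundary**: "each rhombus of the first column may be
split into two equilateral triangles [when `θ₁ = π/3`] … `b(γ)` is the number of visits of `γ`
to triangles adjacent to the boundary", i.e. the number of arcs of `γ` in a column-`0` rhombus
other than the arc `{S, E}` cutting off its lower-right corner (the only arc avoiding the
triangle `NW–NE–SW` that rests on the boundary side `W`). [cite: GlazmanManolescu2019, §1, Fig. 4] -/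
def boundaryVisits (γ : YBWalk D a z) : ℕ :=
  γ.arcs.countP fun p =>
    match arcFace p with
    | some f => f.1 = 0 ∧
        ¬((f.sideOf p.1 = some .S ∧ f.sideOf p.2 = some .E) ∨
          (f.sideOf p.1 = some .E ∧ f.sideOf p.2 = some .S))
    | none => False

/-- **The deformed weight `w_Θ(γ; x, y) = w_Θ(γ) x^{|γ|} y^{b(γ)}`** (real power `x^{|γ|}`).
[cite: GlazmanManolescu2019, eq. (4)] -/
def fugacityWeight (Θ : ℤ → ℝ) (x y : ℝ) (γ : YBWalk D a z) : ℝ :=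
  γ.weight Θ * x ^ (γ.length Θ) * y ^ γ.boundaryVisits

/-- The trivial walk at `a` (no arc; "the empty configuration", of weight `1`).
[cite: GlazmanManolescu2019, §2.1 (after Lemma 2.2)] -/
def trivial (a : MidEdge) : YBWalk D a a where
  mids := [a]
  head_eq := rfl
  getLast_eq := rfl
  nodup := List.nodup_singleton a
  arc_mem p hp := by simp [arcsOf] at hp
  isChain := by simp [arcsOf]
  noncross f h := by simp [arcsOf] at h

/-- The trivial walk has no arc. [folklore] -/
@[simp] theorem arcs_trivial (a : MidEdge) : (trivial a : YBWalk D a a).arcs = [] := rfl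

/-- The trivial walk has weight `1`. [cite: GlazmanManolescu2019, §2.1 ("the empty configuration")] -/
@[simp] theorem weight_trivial (Θ : ℤ → ℝ) (a : MidEdge) : (trivial a : YBWalk D a a).weight Θ = 1 := by
  simp [weight, facesVisited]

/-- The trivial walk has length `0`. [folklore] -/
@[simp] theorem length_trivial (Θ : ℤ → ℝ) (a : MidEdge) : (trivial a : YBWalk D a a).length Θ = 0 := by
  simp [length]

/-- The trivial walk makes no boundary visit. [folklore] -/
@[simp] theorem boundaryVisits_trivial (a : MidEdge) : (trivial a : YBWalk D a a).boundaryVisits = 0 := by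
  simp [boundaryVisits]

/-- Restricting the domain: a walk of `D ⊆ D'` is a walk of `D'`. [folklore] -/
def mapDomain {D D' : Set Face} (h : D ⊆ D') (γ : YBWalk D a z) : YBWalk D' a z where
  mids := γ.mids
  head_eq := γ.head_eq
  getLast_eq := γ.getLast_eq
  nodup := γ.nodup
  arc_mem p hp := by
    obtain ⟨f, hf, hpf⟩ := γ.arc_mem p hp
    exact ⟨f, h hf, hpf⟩
  isChain := γ.isChain
  noncross := γ.noncross

/-- Changing the ambient domain does not change the weight. [folklore] -/
@[simp] theorem weight_mapDomain {D D' : Set Face} (h : D ⊆ D') (Θ : ℤ → ℝ) (γ : YBWalk D a z) :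
    (γ.mapDomain h).weight Θ = γ.weight Θ := rfl

/-- `mapDomain` is injective (the walk is its list of mid-edges). [folklore] -/
theorem mapDomain_injective {D D' : Set Face} (h : D ⊆ D') :
    Function.Injective (mapDomain (a := a) (z := z) h) := fun γ γ' hγ => by
  have := congrArg YBWalk.mids hγ
  exact YBWalk.ext this

end YBWalk

/-! ### Partition functions -/

/-- **The two-point function `G_D(a, z) = Σ_{γ ⊂ D : a → z} w_Θ(γ)`** of the domain `D` (as an
`ℝ≥0∞`-valued sum; negative weights, absent for angles in `[π/3, 2π/3]`, are clamped to `0`).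
[cite: GlazmanManolescu2019, §1 (G_Θ), §4 (G_{Strip_T(Θ)})] -/
def twoPoint (D : Set Face) (Θ : ℤ → ℝ) (a z : MidEdge) : ℝ≥0∞ :=
  ∑' γ : YBWalk D a z, ENNReal.ofReal (γ.weight Θ)

/-- **`G_Θ(a, b)`**, the boundary two-point function of the half-plane `H(Θ)` between the
boundary points of rows `m` and `n`. [cite: GlazmanManolescu2019, §1 (display before Theorem 1)] -/
def halfPlaneTwoPoint (Θ : ℤ → ℝ) (m n : ℤ) : ℝ≥0∞ :=
  twoPoint halfPlane Θ (boundaryPoint m) (boundaryPoint n)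

/-- **`B_{T,Θ}`, the partition function of bridges of width `T`**: walks of `Strip_T(Θ)` from `0`
to (any mid-edge `vert T j` of) its right boundary. [cite: GlazmanManolescu2019, eq. (2)] -/
def bridgePartitionFunction (T : ℕ) (Θ : ℤ → ℝ) : ℝ≥0∞ :=
  ∑' j : ℤ, twoPoint (strip T) Θ origin (.vert T j)

/-- **`SAW_Θ(x, y) = Σ_{γ starts at 0} w_Θ(γ; x, y)`**, over all walks of `H(Θ)` from the origin
(any end). [cite: GlazmanManolescu2019, §1 (display before Definition 1.1)] -/
def fugacityPartitionFunction (Θ : ℤ → ℝ) (x y : ℝ) : ℝ≥0∞ :=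
  ∑' p : (z : MidEdge) × YBWalk halfPlane origin z, ENNReal.ofReal (p.2.fugacityWeight Θ x y)

/-- The set `{y ≥ 0 | ∀ 0 < x < 1, SAW_Θ(x, y) < ∞}` whose supremum is the critical fugacity.
[cite: GlazmanManolescu2019, Definition 1.1, eq. (5)] -/
def subcriticalFugacities (Θ : ℤ → ℝ) : Set ℝ :=
  {y | 0 ≤ y ∧ ∀ x, 0 < x → x < 1 → fugacityPartitionFunction Θ x y < ⊤}

/-- **The critical (surface) fugacity `y_c(Θ) = sup{y ≥ 0 | ∀ 0 < x < 1, SAW_Θ(x, y) < ∞}`**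
(real supremum; `0` if the set were unbounded). [cite: GlazmanManolescu2019, Definition 1.1, eq. (5)] -/
def criticalSurfaceFugacity (Θ : ℤ → ℝ) : ℝ := sSup (subcriticalFugacities Θ)

/-! ### Named facts (statements only) -/

/-- **Glazman–Manolescu, Theorem 1.** "Let `Θ = {θ_k}_{k∈ℕ}`, where `θ_k ∈ [π/3, 2π/3]` for all
`k`. Then `G_Θ(a, b) = G_{π/3}(a, b)` for any two points `a` and `b` on the boundary of the right
half-plane." (Here `Θ : ℤ → ℝ`; the hypothesis is imposed at all `k`, values at `k < 0` being
irrelevant.) [cite: GlazmanManolescu2019, Theorem 1] -/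
def GlazmanManolescu2019_thm1 : Prop :=
  ∀ Θ : ℤ → ℝ, (∀ k, Θ k ∈ Set.Icc (π / 3) (2 * π / 3)) →
    ∀ m n : ℤ, halfPlaneTwoPoint Θ m n = halfPlaneTwoPoint (fun _ => π / 3) m n

/-- **Glazman–Manolescu, Theorem 2.** "Let `Θ = {θ_k}_{k∈ℕ}`, where `θ_k ∈ [π/3, 2π/3]` for all
`k`. Then `B_{T,Θ} → 0` as `T → ∞`." [cite: GlazmanManolescu2019, Theorem 2] -/
def GlazmanManolescu2019_thm2 : Prop :=
  ∀ Θ : ℤ → ℝ, (∀ k, Θ k ∈ Set.Icc (π / 3) (2 * π / 3)) →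
    Tendsto (fun T => bridgePartitionFunction T Θ) atTop (𝓝 0)

/- The two UNDISCHARGED named facts `GlazmanManolescu2019_prop11` (Proposition 1.1, mis-quoted
without the cube) and `GlazmanManolescu2019_thm3` (Theorem 3, `y_c(Θ) = 1 + √2`, with its corollary
`GlazmanManolescu2019_thm3.criticalSurfaceFugacity_eq`) were MOVED verbatim to
`YangBaxterSAWFacts.lean` (module split for import-cone hygiene, item `defn-YangBaxterSAWFacts`):
this file now holds only definitions, proved API lemmas and the two facts (Theorems 1, 2) that are
discharged in `YangBaxterSAWTheoremsHolds.lean`. -/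

/-! ### API -/

/-- An empty rhombus has weight `1`. [cite: GlazmanManolescu2019, Fig. 1] -/
@[simp] theorem localWeight_nil (θ : ℝ) : localWeight θ [] = 1 := rfl

/-- The origin is embedded at `0 ∈ ℂ`. [cite: GlazmanManolescu2019, §1] -/
@[simp] theorem midpoint_origin (Θ : ℤ → ℝ) : midpoint Θ origin = 0 := by
  simp [midpoint, origin, corner]

/-- The strip is part of the half-plane. [cite: GlazmanManolescu2019, §1] -/
theorem strip_subset_halfPlane (T : ℕ) : strip T ⊆ halfPlane := fun _ h => h.1

/-- The rectangle is part of the strip. [cite: GlazmanManolescu2019, §2.1] -/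
theorem rect_subset_strip (T L : ℕ) : rect T L ⊆ strip T := fun _ h => ⟨h.1, h.2.1⟩

/-- `G_D(a, a) ≥ 1`: the trivial walk contributes `1`. [folklore] -/
theorem one_le_twoPoint_self (D : Set Face) (Θ : ℤ → ℝ) (a : MidEdge) : 1 ≤ twoPoint D Θ a a := by
  calc (1 : ℝ≥0∞) = ENNReal.ofReal ((YBWalk.trivial a : YBWalk D a a).weight Θ) := by simp
    _ ≤ twoPoint D Θ a a := ENNReal.le_tsum (YBWalk.trivial a)

/-- Monotonicity of the two-point function in the domain. [folklore] -/
theorem twoPoint_mono {D D' : Set Face} (h : D ⊆ D') (Θ : ℤ → ℝ) (a z : MidEdge) :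
    twoPoint D Θ a z ≤ twoPoint D' Θ a z := by
  unfold twoPoint
  calc ∑' γ : YBWalk D a z, ENNReal.ofReal (γ.weight Θ)
      = ∑' γ : YBWalk D a z, ENNReal.ofReal ((γ.mapDomain h).weight Θ) := by simp
    _ ≤ ∑' γ' : YBWalk D' a z, ENNReal.ofReal (γ'.weight Θ) :=
        ENNReal.tsum_comp_le_tsum_of_injective (YBWalk.mapDomain_injective h)
          (fun γ' : YBWalk D' a z => ENNReal.ofReal (γ'.weight Θ))

/-- At `θ = π/3`, `w₂ = 0` (two `(π−θ)`-corner arcs would both cross the short diagonal).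
[cite: GlazmanManolescu2019, §1 ("if θ = π/3, then w₂ = 0")] -/
theorem weightW2_pi_div_three : weightW2 (π / 3) = 0 := by
  have h : 15 * π / 8 + 3 * (π / 3) / 8 = 2 * π := by ring
  simp [weightW2, h]

/-- At `θ = π/3`, `u₁ = x_c = 1/√(2+√2)`, the critical fugacity of the hexagonal lattice
(`Literature.Probability.RandomPlanarGeometry.SAW.hexCriticalFugacity`). [cite: GlazmanManolescu2019, §1, Fig. 2 ("u₁ = x_c")] -/
theorem weightU1_pi_div_three : weightU1 (π / 3) = hexCriticalFugacity := by
  have h1 : 5 * π / 8 + 3 * (π / 3) / 8 = π / 4 + π / 2 := by ring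
  have h2 : 5 * π / 4 + 3 * (π / 3) / 8 = (π / 2 - π / 8) + π := by ring
  have h3 : 5 * π / 8 - 3 * (π / 3) / 8 = π / 2 := by ring
  have h4 : (5 * π / 4 : ℝ) = π / 4 + π := by ring
  have hc : 0 < cos (π / 8) := by
    rw [cos_pi_div_eight]; positivity
  rw [weightU1, weightDen, h1, h2, h3, h4, sin_add_pi, sin_add_pi, sin_add_pi_div_two,
    sin_pi_div_two_sub, sin_pi_div_two, sin_pi_div_four, cos_pi_div_four, hexCriticalFugacity,
    cos_pi_div_eight]
  have hs : (0 : ℝ) < Real.sqrt (2 + Real.sqrt 2) := by positivity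
  have h2' : Real.sqrt 2 * Real.sqrt 2 = 2 := Real.mul_self_sqrt (by norm_num)
  field_simp
  nlinarith [h2']

end Literature.Probability.RandomPlanarGeometry.SAW.YangBaxter
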